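import Summits.ResolutionOfSingularities.ResolutionOfSingularities.Theorems.FrobeniusLadderFInjectiveMacaulayficationOmegaOneS2KNewtonKFanTables
import Summits.ResolutionOfSingularities.ResolutionOfSingularities.Theorems.FrobeniusLadderFInjectiveMacaulayficationOmegaOneGlobalCureFanCert
import HarnessLib

/-!
# TABLES (fan side, B) of the BED Ω₁ refined class model X̃₂ class-route certificate: the integer inverse columns `VinvTL` of the 1223 chart matrices — REUSED from ✓ `OmegaOneGlobalCureFanCert.VINV_S2` (same cone order) (namespace `OmegaOneS2KNewtonKFan`)

Support file for crux stmt-ResolutionOfSingularities-15315 (`FrobeniusLadder.FInjectiveMacaulayfication`), chain w45a.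
[OURS · L1 W4.5a] — NOT a statement of any manuscript; AI-written (script-generated by `work/gen_newtonK.py s2k` from the certificate JSON below), weaker than expert review.

WHAT. (Ω₁ GLOBAL PATCH F6 W1/W2) THE REFINED CLASS MODEL X̃₂ = Bl_{K″} X_{B9} (centre K″ ALONE: all cover records ≤ 2 vertices) of the global cure fan Σ₂ (res-L1-w45a-stub-3 g14; kit j329694 fan, ✓ `OmegaOneGlobalCureFanTables1` /
`…Cert`; blueprint `g14/F6-ARCHITECTURE.md`): chart tables + cover records in the g12 class-route dialect, so that the unchanged FHalfRow pipeline yields FULL of X̃₂ everywhere: the hypersurface `f_B9 = z² + x⁹ + y⁹ + u⁹ + t⁹` (`(x,y,u,t,z) = (X 0,…,X 4)`, EVERY characteristic p ∤ 18 (p-uniform); specimen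
package `B9Specimen`) and the PRODUCT monomial centre `𝔪·K` whose normal fan is res-L1-w45a-stub-3 g14's global cure fan Σ₂ (`L/res-L1-w45a-stub-3/g14/jobS2/fan_s2.json` = kit j329694: Σ(B9) joined with the local cure fans F9/F10/Σ₄
sha16 910cd0da48e587c2: 1223 unimodular cones on 139 rays, refining the NEWTON fan of `f_B9` and `Σ(𝔪)`; kernel certificate ⊙ `OmegaOneGlobalCureFanCert` (unimodular, refines Σ(B9), projective, exit tags):
1223 maximal cones / 139 rays), `K` = the lattice polyhedron of the LP-minimal strictly concave integer support function on that fan (kit job j329694-konly, certificate sha16 abe6ee2c854b2a20):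
K-vertices, K-side chart neighbours and pure powers, `|K| = 6032` generators (table `KL2`, chunks of 50); the generators of `𝔪·K` are the PRODUCT TABLE
`AL2 := FanCheckProduct.prodGens 5 KL2` (`6032` vectors, never written out); chart records `CL` (rays, vertex and neighbour index pairs into `AL2`, no exceptional vectors),
integer inverse columns `VinvTL`, vertex vectors `MV2` (chunks of 50), sparse multi-vertex cover records `RLM2_j` (same kit job), the local chart-matrix copy `Vq c` and, for the
class route, the NEWTON MINIMISER table `U0 c ∈ supp f_B9` (the monomial of `f_B9` minimising every row of `V c` — the fan refines `Σ_f`). NO strict transforms, NO Fedder cells: the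
consumer is the CLASS THEOREM ✓ p656605 `FHalfRowOfNewtonNondegenerate.fHalfRow_of_weaklyNondegenerate` (weak non-degeneracy `B9PointFloorRowClass.weaklyNondegenerate_b9`), via
`OmegaOneS2KNewtonKFanChecks` / `…CoverChecks` (one `decide +kernel` each) → `OmegaOneS2KNewtonKFan` (binders) → `OmegaOneS2ClassRow (to be written: FULL of X̃₂ = Bl_{𝔪K″}X_{B9} at every stalk, principal branch of F6)`.
Definitions are plain data tables (no instances, no notation); no named facts. [folklore; cite: CoxLittleSchenck2011, §2.3]
-/

-- single-problem summit: the doubled namespace component is forced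
set_option linter.dupNamespace false

noncomputable section

namespace Summit.ResolutionOfSingularities.ResolutionOfSingularities.Theorems.FInjectiveMacaulayfication.OmegaOneS2KNewtonKFan

open Summit.ResolutionOfSingularities.ResolutionOfSingularities.Theorems.FInjectiveMacaulayfication

/-- The integer inverse COLUMNS of the chart matrices (`V c · W c = 1`): the certified table of ✓ `OmegaOneGlobalCureFanCert` (cones in the same order). [generated] -/
def VinvTL : List (List (List ℤ)) := OmegaOneGlobalCureFanCert.VINV_S2

end Summit.ResolutionOfSingularities.ResolutionOfSingularities.Theorems.FInjectiveMacaulayfication.OmegaOneS2KNewtonKFan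

end
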